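import Summits.HodgeConjecture.FermatCycles.ConditionQObstruction
import HarnessLib

/-!
# Obstructions to `(Q⁴ₘ)`, bucketed form: an `O(m² log m)` kernel certificate that an additive functional vanishes on `M'ₘ`

HONEST FRAMING: explicit algebraic cycles for specific Hodge classes on Fermat/Delsarte varieties;
residual open instances listed; no claim on general Hodge.

Topic path `Summits/HodgeConjecture/FermatCycles/` of cell `pub-hfermat` (new work, not literature: the tool certifying the FALSE entries of
the cell's `(Q⁴ₘ)` table, `pub-hfermat-enum/P4-TABLE.md` §(Q⁴ₘ), at the larger levels). Companion of `ConditionQObstruction.lean`, whose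
enumerations `checkFour` (`m³` quadruples) and `checkSixRange` (`≈ m⁴/8` juxtapositions of two zero-sum triples) it replaces by two
`m²`-enumerations with table look-ups; the functional `Φ_c`, `pairsB`, and the final contradiction are that file's.

THE METHOD. An additive functional `Φ_c(s) = Σ_{x ∈ s} c(x)` vanishing on every generator of Shioda's `M'ₘ` (pairs, Hodge `4`-multisets,
semi-decomposable Hodge sextuples; [Shioda1979HodgeFermat] §4 p. 183) vanishes on `M'ₘ`, so `Φ_c(s) ≠ 0` on a Hodge sextuple `s` refutes
`(Q⁴ₘ)` ([Shioda1981FermatType], Appendix, is the case `m = 25`). Vanishing on the generators is decided WITHOUT enumerating them: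

* a semi-decomposable Hodge sextuple is `T₁ + T₂` with `Tᵢ` zero-sum triples of non-zero residues; writing `δ_T(t) = ⟨ta⟩ + ⟨tb⟩ + ⟨tc⟩`
  (`T = (a, b, c)`, `t` a unit), Shioda's equations (2) for `T₁ + T₂` say exactly `δ_{T₂}(t) = 3m − δ_{T₁}(t)` for every unit `t`. Hence
  `Φ_c` kills all of them iff for every triple `T₁` and every triple `T₂` whose norm vector is the COMPLEMENT `3m − δ_{T₁}` one has
  `Φ_c(T₁) + Φ_c(T₂) = 0`. The check `checkSixChunk` runs over the `m²` triples `T` (chunked by first representative), looks up, in a search tree `𝒯` keyed by (an encoding of)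
  the norm vector, the value stored under `T`'s own key — it must be `Φ_c(T)` — and the value `v` stored under the complementary key, if
  any — it must satisfy `v + Φ_c(T) = 0`. Soundness (`phi_semi_of_checkSixChunk`) uses nothing about `𝒯` except that look-up is a function:
  for complementary `T₁, T₂` the look-up of `T₂`'s key returns `Φ_c(T₂)` (check at `T₂`), and that key IS the complementary key of `T₁`, so
  the check at `T₁` gives `Φ_c(T₂) + Φ_c(T₁) = 0`. In the level files `𝒯 = buildSix m c` (all triples inserted into a plain binary search
  tree under scrambled keys), but ANY tree passing the check would do;
* likewise a Hodge `4`-multiset `{a, b, c, d}` is two pairs `(a, b)`, `(c, d)` with complementary norm vectors `⟨tc⟩ + ⟨td⟩ = 2m − (⟨ta⟩ + ⟨tb⟩)`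
  (`checkFourChunk`, `phi_four_of_checkFourChunk`, tree `buildFour m c`). The chunks exist only to bound the kernel's memory per
  theorem (its reduction cache); at `m ≤ 70` one chunk suffices.

`not_conditionQ_four_of_buckets` assembles the refutation exactly as `not_conditionQ_four_of_obstruction` does. No definition of a `Prop`, no
named fact; nothing here concerns the truth of the Hodge conjecture for any `Xⁿₘ` — a failure of `(Q⁴ₘ)` says only that Shioda's 1979 method
(even in its stable form) does not reach all Hodge classes of `X⁴ₘ`. The functionals are found outside Lean (`code/lit/q4/sepfunc2.py`,
rational null space of the bucket-reduced generator matrix; implementation 2 of the level verdicts = `code/enum/q4table.py`).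

References: [Shioda1979HodgeFermat] T. Shioda, Math. Ann. 245 (1979) §4 pp. 183–184; [Shioda1981FermatType] T. Shioda, Math. Ann. 258 (1981),
Appendix pp. 78–79; [Shioda1979PJA] T. Shioda, Proc. Japan Acad. 55A (1979) §1 eqs. (2)–(3).
-/

namespace Summit.HodgeConjecture.FermatCycles.ConditionQObstruction

open Multiset
open Literature.AlgebraicGeometry.HodgeTheory Literature.AlgebraicGeometry.HodgeTheory.FermatCharacter
open Literature.AlgebraicGeometry.Shioda1979 Literature.AlgebraicGeometry.Shioda1982

/-! ### A look-up tree (plain binary search tree; no invariant is ever used — only that `find?` is a function) -/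

/-- Binary search tree with `ℕ` keys and `ℤ` values. [folklore] -/
inductive KTree where
  | leaf : KTree
  | node : KTree → ℕ → ℤ → KTree → KTree

/-- Look-up. [folklore] -/
def KTree.find? : KTree → ℕ → Option ℤ
  | .leaf, _ => none
  | .node l k v r, x => if x < k then l.find? x else if k < x then r.find? x else some v

/-- Insertion (the value on an equal key is replaced). The modified child is MATCHED before the node is rebuilt, so that under the
kernel's lazy reduction the accumulated tree never contains a chain of pending insertions (a plain `node (l.insert x w) k v r` would
nest one closure per insertion and overflow the kernel's recursion depth at `m = 100`). [folklore] -/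
def KTree.insert : KTree → ℕ → ℤ → KTree
  | .leaf, x, w => .node .leaf x w .leaf
  | .node l k v r, x, w =>
    if x < k then
      match l.insert x w with
      | .leaf => .node .leaf k v r
      | .node l₁ k₁ v₁ r₁ => .node (.node l₁ k₁ v₁ r₁) k v r
    else if k < x then
      match r.insert x w with
      | .leaf => .node l k v .leaf
      | .node l₁ k₁ v₁ r₁ => .node l k v (.node l₁ k₁ v₁ r₁)
    else .node l k w r

/-- Insert a list of `(key, value)` items, forcing the tree after every insertion (see `KTree.insert`). [folklore] -/
def KTree.insertList : KTree → List (ℕ × ℤ) → KTree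
  | T, [] => T
  | T, (x, w) :: rest =>
    match T.insert x w with
    | .leaf => KTree.insertList .leaf rest
    | .node l k v r => KTree.insertList (.node l k v r) rest

/-- One step of the key hash: a polynomial hash modulo the prime `4294967291` in the base `B` (small numbers throughout; insertion order
pseudo-random ⇒ shallow tree). Injectivity is NOT needed anywhere: a collision can only make a check fail. [folklore] -/
def mixStep (B acc d : ℕ) : ℕ := (acc * B + d) % 4294967291

/-- The units entering the keys: the first `k` entries of `unitsList N` (any sub-family of Shioda's equations gives a sound key; `k` is
chosen per level, outside Lean, as the shortest prefix on which the check passes). [folklore] -/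
def keyUnits (N k : ℕ) : List ℕ := (unitsList N).take k

/-- Hashed encoding of a digit vector over `keyUnits N k`. [folklore] -/
def encode (N k B : ℕ) (f : ℕ → ℕ) : ℕ := (keyUnits N k).foldl (fun acc t ↦ mixStep B acc (f t)) 7

/-- Folds with pointwise-equal digits agree. [folklore] -/
theorem foldl_digits_congr {L : List ℕ} (step : ℕ → ℕ → ℕ) {f g : ℕ → ℕ} (h : ∀ t ∈ L, f t = g t) (acc : ℕ) :
    L.foldl (fun acc t ↦ step acc (f t)) acc = L.foldl (fun acc t ↦ step acc (g t)) acc := by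
  induction L generalizing acc with
  | nil => rfl
  | cons t L ih =>
    simp only [List.foldl_cons]
    rw [h t List.mem_cons_self]
    exact ih (fun u hu ↦ h u (List.mem_cons_of_mem t hu)) _

/-- Equal digits at the units give equal codes. [folklore] -/
theorem encode_congr {N k B : ℕ} {f g : ℕ → ℕ} (h : ∀ t ∈ unitsList N, f t = g t) : encode N k B f = encode N k B g := by
  unfold encode keyUnits
  rw [foldl_digits_congr (mixStep B) fun t ht ↦ h t (List.mem_of_mem_take ht)]

/-! ### Pairs: a Hodge `4`-multiset is two pairs with complementary norm vectors -/

/-- Norm digit of the pair `(a, b)` at `t`: `⟨ta⟩ + ⟨tb⟩`. [cite: Shioda1979PJA, §1 eq. (2)] -/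
def digit2 (N t a b : ℕ) : ℕ := t * a % N + t * b % N

/-- Key of a pair: its norm vector (on the key units). [folklore] -/
def key2 (N k a b : ℕ) : ℕ := encode N k (4 * N) fun t ↦ digit2 N t a b

/-- Complementary key of a pair: the norm vector `2N − δ`. [folklore] -/
def ckey2 (N k a b : ℕ) : ℕ := encode N k (4 * N) fun t ↦ 2 * N - digit2 N t a b

/-- `Φ_c` on a pair of representatives. [folklore] -/
def phi2 (c : List ℤ) (a b : ℕ) : ℤ := c.getD a 0 + c.getD b 0

/-- The pair check: own key ↦ own value, complementary key ↦ opposite value. [folklore] -/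
def checkPair (N k : ℕ) (c : List ℤ) (T : KTree) (a b : ℕ) : Bool :=
  (T.find? (key2 N k a b) == some (phi2 c a b)) && (T.find? (ckey2 N k a b)).all fun v ↦ v + phi2 c a b == 0

/-- `Φ_c` vanishes on the Hodge `4`-multisets: pair checks against the tree `T` for representatives `a ∈ [a₀, a₀ + len)`, `a ≤ b < N`.
[cite: Shioda1979HodgeFermat, §4 p. 183 (Mₘ(2) ⊂ M'ₘ)] -/
def checkFourChunk (N k : ℕ) (c : List ℤ) (T : KTree) (a0 len : ℕ) : Bool :=
  (List.range' a0 len).all fun a ↦ (List.range' a (N - a)).all fun b ↦ checkPair N k c T a b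

/-- The items `(key, Φ_c)` of the pairs `1 ≤ a ≤ b < N`. [folklore] -/
def itemsFour (N k : ℕ) (c : List ℤ) : List (ℕ × ℤ) :=
  (List.range' 1 (N - 1)).flatMap fun a ↦ (List.range' a (N - a)).map fun b ↦ (key2 N k a b, phi2 c a b)

/-- The tree of the pairs (keys = hashed norm vectors, values = `Φ_c`). [folklore] -/
def buildFour (N k : ℕ) (c : List ℤ) : KTree := KTree.insertList .leaf (itemsFour N k c)

/-! ### Triples: a semi-decomposable Hodge sextuple is two zero-sum triples with complementary norm vectors -/

/-- Third entry of the zero-sum triple on `(a, b)`: the representative of `−(a+b)`. [folklore] -/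
def third (N a b : ℕ) : ℕ := (N - (a + b) % N) % N

/-- Norm digit of the triple `(a, b, −(a+b))` at `t`. [cite: Shioda1979PJA, §1 eq. (2)] -/
def digit3 (N t a b : ℕ) : ℕ := t * a % N + t * b % N + t * third N a b % N

/-- Key of a triple: its norm vector (on the key units). [folklore] -/
def key3 (N k a b : ℕ) : ℕ := encode N k (4 * N) fun t ↦ digit3 N t a b

/-- Complementary key of a triple: the norm vector `3N − δ`. [folklore] -/
def ckey3 (N k a b : ℕ) : ℕ := encode N k (4 * N) fun t ↦ 3 * N - digit3 N t a b

/-- `Φ_c` on a triple of representatives. [folklore] -/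
def phi3 (N : ℕ) (c : List ℤ) (a b : ℕ) : ℤ := c.getD a 0 + c.getD b 0 + c.getD (third N a b) 0

/-- The triple check: own key ↦ own value, complementary key ↦ opposite value. [folklore] -/
def checkTriple (N k : ℕ) (c : List ℤ) (T : KTree) (a b : ℕ) : Bool :=
  (T.find? (key3 N k a b) == some (phi3 N c a b)) && (T.find? (ckey3 N k a b)).all fun v ↦ v + phi3 N c a b == 0

/-- `Φ_c` vanishes on the semi-decomposable Hodge sextuples: triple checks against the tree `T` for representatives
`a ∈ [a₀, a₀ + len)`, `a ≤ b < N` (triples with a zero entry skipped). [cite: Shioda1979HodgeFermat, §4 p. 183 (Mₘ(3)^sd ⊂ M'ₘ)] -/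
def checkSixChunk (N k : ℕ) (c : List ℤ) (T : KTree) (a0 len : ℕ) : Bool :=
  (List.range' a0 len).all fun a ↦ (List.range' a (N - a)).all fun b ↦ third N a b == 0 || checkTriple N k c T a b

/-- The items `(key, Φ_c)` of the zero-sum triples on `1 ≤ a ≤ b < N` with non-zero third entry. [folklore] -/
def itemsSix (N k : ℕ) (c : List ℤ) : List (ℕ × ℤ) :=
  (List.range' 1 (N - 1)).flatMap fun a ↦ (List.range' a (N - a)).filterMap fun b ↦
    if third N a b = 0 then none else some (key3 N k a b, phi3 N c a b)

/-- The tree of the triples (keys = hashed norm vectors, values = `Φ_c`). [folklore] -/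
def buildSix (N k : ℕ) (c : List ℤ) : KTree := KTree.insertList .leaf (itemsSix N k c)

/-! ### Soundness -/

/-- From a passing look-up pair: if the complementary key of one item is the own key of another, the values are opposite. [folklore] -/
theorem opposite_of_checks {T : KTree} {k k' : ℕ} {v w : ℤ}
    (h1 : ((T.find? k' == some w) && (T.find? k).all fun u ↦ u + w == 0) = true)
    (h2 : (T.find? k == some v) = true) : v + w = 0 := by
  rw [Bool.and_eq_true] at h1
  rw [beq_iff_eq] at h2
  have h := h1.2
  rw [h2, Option.all_some, beq_iff_eq] at h
  exact h

/-- Sorted case of `phi_four_of_checkFourChunk`. [cite: Shioda1979HodgeFermat, §4 p. 183] -/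
theorem phi_four_sorted {N k : ℕ} [NeZero N] {c : List ℤ} {T : KTree} (chunks : List (ℕ × ℕ))
    (hcov : ∀ a, 1 ≤ a → a < N → ∃ p ∈ chunks, p.1 ≤ a ∧ a < p.1 + p.2) (h4 : ∀ p ∈ chunks, checkFourChunk N k c T p.1 p.2 = true)
    (a b c' d : ZMod N) (hab : a.val ≤ b.val) (hcd : c'.val ≤ d.val) (h : IsHodgeMultiset ({a, b, c', d} : Multiset (ZMod N))) :
    phi N c {a, b, c', d} = 0 := by
  have hN : 0 < N := Nat.pos_of_ne_zero (NeZero.ne N)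
  rw [isHodgeMultiset_iff_unitsList] at h
  obtain ⟨⟨h0, -⟩, hall⟩ := h
  have hnz : ∀ x : ZMod N, x ≠ 0 → 1 ≤ x.val := fun x hx ↦
    Nat.one_le_iff_ne_zero.mpr fun e ↦ hx ((ZMod.val_eq_zero x).mp e)
  have ha := hnz a (h0 a (by simp)); have hc := hnz c' (h0 c' (by simp))
  have hav := ZMod.val_lt a; have hbv := ZMod.val_lt b; have hcv := ZMod.val_lt c'; have hdv := ZMod.val_lt d
  -- the norm vectors of (a, b) and (c', d) are complementary
  have hsum : ∀ t ∈ unitsList N, digit2 N t c'.val d.val = 2 * N - digit2 N t a.val b.val := by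
    intro t ht
    have e := hall t ht
    simp only [insert_eq_cons, map_cons, map_singleton, sum_cons, sum_singleton, card_cons, card_singleton] at e
    unfold digit2; omega
  have hkey : key2 N k c'.val d.val = ckey2 N k a.val b.val := encode_congr hsum
  -- extract the two checks
  have row : ∀ x : ZMod N, 1 ≤ x.val → ((List.range' x.val (N - x.val)).all fun y ↦ checkPair N k c T x.val y) = true := by
    intro x hx
    obtain ⟨p, hp, hp1, hp2⟩ := hcov x.val hx (ZMod.val_lt x)
    have hc := h4 p hp
    unfold checkFourChunk at hc
    rw [List.all_eq_true] at hc
    exact hc x.val (List.mem_range'_1.mpr ⟨hp1, hp2⟩)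
  have hA := row a ha; rw [List.all_eq_true] at hA
  have hAB := hA b.val (List.mem_range'_1.mpr ⟨hab, by omega⟩)
  have hC := row c' hc; rw [List.all_eq_true] at hC
  have hCD := hC d.val (List.mem_range'_1.mpr ⟨hcd, by omega⟩)
  unfold checkPair at hAB hCD
  rw [Bool.and_eq_true] at hCD
  rw [← hkey] at hAB
  have hopp := opposite_of_checks hAB hCD.1
  simp only [phi, phi2, insert_eq_cons, map_cons, map_singleton, sum_cons, sum_singleton] at hopp ⊢
  linarith

/-- **`Φ_c` vanishes on the Hodge `4`-multisets** when the chunks of `checkFourChunk` cover `[1, N)` (for any tree, any `k`).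
[cite: Shioda1979HodgeFermat, §4 p. 183] -/
theorem phi_four_of_checkFourChunk {N k : ℕ} [NeZero N] {c : List ℤ} {T : KTree} (chunks : List (ℕ × ℕ))
    (hcov : ∀ a, 1 ≤ a → a < N → ∃ p ∈ chunks, p.1 ≤ a ∧ a < p.1 + p.2) (h4 : ∀ p ∈ chunks, checkFourChunk N k c T p.1 p.2 = true)
    (a b c' : ZMod N) (h : IsHodgeMultiset ({a, b, c', -(a + b + c')} : Multiset (ZMod N))) :
    phi N c {a, b, c', -(a + b + c')} = 0 := by
  generalize -(a + b + c') = d at h ⊢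
  have sw1 : ({a, b, c', d} : Multiset (ZMod N)) = {b, a, c', d} := by simp only [insert_eq_cons]; exact cons_swap a b _
  have sw2 : ({a, b, c', d} : Multiset (ZMod N)) = {a, b, d, c'} := by rw [pair_comm c' d]
  rcases le_total a.val b.val with hab | hba <;> rcases le_total c'.val d.val with hcd | hdc
  · exact phi_four_sorted chunks hcov h4 a b c' d hab hcd h
  · rw [sw2] at h ⊢; exact phi_four_sorted chunks hcov h4 a b d c' hab hdc h
  · rw [sw1] at h ⊢; exact phi_four_sorted chunks hcov h4 b a c' d hba hcd h
  · rw [sw1, pair_comm c' d] at h ⊢; exact phi_four_sorted chunks hcov h4 b a d c' hba hdc h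

/-- Sorted case of `phi_semi_of_checkSixChunk`. [cite: Shioda1979HodgeFermat, §4 p. 183] -/
theorem phi_semi_sorted' {N k : ℕ} [NeZero N] {c : List ℤ} {T : KTree} (chunks : List (ℕ × ℕ))
    (hcov : ∀ a, 1 ≤ a → a < N → ∃ p ∈ chunks, p.1 ≤ a ∧ a < p.1 + p.2) (h6 : ∀ p ∈ chunks, checkSixChunk N k c T p.1 p.2 = true)
    (a b c' d : ZMod N) (hab : a.val ≤ b.val) (hcd : c'.val ≤ d.val)
    (h : IsHodgeMultiset (({a, b, -(a + b)} : Multiset (ZMod N)) + {c', d, -(c' + d)})) :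
    phi N c (({a, b, -(a + b)} : Multiset (ZMod N)) + {c', d, -(c' + d)}) = 0 := by
  have hN : 0 < N := Nat.pos_of_ne_zero (NeZero.ne N)
  have hx : (-(a + b)).val = third N a.val b.val := by unfold third; rw [ZMod.neg_val', ZMod.val_add]
  have hy : (-(c' + d)).val = third N c'.val d.val := by unfold third; rw [ZMod.neg_val', ZMod.val_add]
  rw [isHodgeMultiset_iff_unitsList] at h
  obtain ⟨⟨h0, -⟩, hall⟩ := h
  have hnz : ∀ x : ZMod N, x ≠ 0 → 1 ≤ x.val := fun x hx ↦
    Nat.one_le_iff_ne_zero.mpr fun e ↦ hx ((ZMod.val_eq_zero x).mp e)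
  have ha := hnz a (h0 a (by simp)); have hc := hnz c' (h0 c' (by simp))
  have hx0 := hnz (-(a + b)) (h0 _ (by simp)); have hy0 := hnz (-(c' + d)) (h0 _ (by simp))
  rw [hx] at hx0; rw [hy] at hy0
  have hav := ZMod.val_lt a; have hbv := ZMod.val_lt b; have hcv := ZMod.val_lt c'; have hdv := ZMod.val_lt d
  -- the norm vectors of the two triples are complementary
  have hsum : ∀ t ∈ unitsList N, digit3 N t c'.val d.val = 3 * N - digit3 N t a.val b.val := by
    intro t ht
    have e := hall t ht
    simp only [insert_eq_cons, Multiset.map_add, Multiset.sum_add, Multiset.card_add, map_cons, map_singleton, sum_cons,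
      sum_singleton, card_cons, card_singleton, hx, hy] at e
    unfold digit3; omega
  have hkey : key3 N k c'.val d.val = ckey3 N k a.val b.val := encode_congr hsum
  -- extract the two checks
  have row : ∀ x : ZMod N, 1 ≤ x.val →
      ((List.range' x.val (N - x.val)).all fun y ↦ third N x.val y == 0 || checkTriple N k c T x.val y) = true := by
    intro x hx
    obtain ⟨p, hp, hp1, hp2⟩ := hcov x.val hx (ZMod.val_lt x)
    have hc := h6 p hp
    unfold checkSixChunk at hc
    rw [List.all_eq_true] at hc
    exact hc x.val (List.mem_range'_1.mpr ⟨hp1, hp2⟩)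
  have hA := row a ha; rw [List.all_eq_true] at hA
  have hAB := hA b.val (List.mem_range'_1.mpr ⟨hab, by omega⟩)
  have hC := row c' hc; rw [List.all_eq_true] at hC
  have hCD := hC d.val (List.mem_range'_1.mpr ⟨hcd, by omega⟩)
  rw [Bool.or_eq_true, beq_iff_eq] at hAB hCD
  replace hAB := hAB.resolve_left (by omega)
  replace hCD := hCD.resolve_left (by omega)
  unfold checkTriple at hAB hCD
  rw [Bool.and_eq_true] at hCD
  rw [← hkey] at hAB
  have hopp := opposite_of_checks hAB hCD.1
  rw [phi_add]
  simp only [phi, phi3, insert_eq_cons, map_cons, map_singleton, sum_cons, sum_singleton, hx, hy] at hopp ⊢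
  linarith

/-- **`Φ_c` vanishes on the semi-decomposable Hodge sextuples** when the chunks of `checkSixChunk` cover `[1, N)` (for any tree, any `k`).
[cite: Shioda1979HodgeFermat, §4 p. 183] -/
theorem phi_semi_of_checkSixChunk {N k : ℕ} [NeZero N] {c : List ℤ} {T : KTree} (chunks : List (ℕ × ℕ))
    (hcov : ∀ a, 1 ≤ a → a < N → ∃ p ∈ chunks, p.1 ≤ a ∧ a < p.1 + p.2) (h6 : ∀ p ∈ chunks, checkSixChunk N k c T p.1 p.2 = true)
    (a b c' d : ZMod N) (h : IsHodgeMultiset (({a, b, -(a + b)} : Multiset (ZMod N)) + {c', d, -(c' + d)})) :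
    phi N c (({a, b, -(a + b)} : Multiset (ZMod N)) + {c', d, -(c' + d)}) = 0 := by
  have hswap : ∀ x y : ZMod N, ({x, y, -(x + y)} : Multiset (ZMod N)) = {y, x, -(y + x)} := by
    intro x y; rw [add_comm y x]; simp [insert_eq_cons, cons_swap]
  rcases le_total a.val b.val with hab | hba <;> rcases le_total c'.val d.val with hcd | hdc
  · exact phi_semi_sorted' chunks hcov h6 a b c' d hab hcd h
  · rw [hswap c' d] at h ⊢; exact phi_semi_sorted' chunks hcov h6 a b d c' hab hdc h
  · rw [hswap a b] at h ⊢; exact phi_semi_sorted' chunks hcov h6 b a c' d hba hcd h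
  · rw [hswap a b, hswap c' d] at h ⊢; exact phi_semi_sorted' chunks hcov h6 b a d c' hba hdc h

/-- **`Φ_c` vanishes on `M'_N`** when it is odd and passes the two bucketed checks (chunks covering `[1, N)`).
[cite: Shioda1979HodgeFermat, §4 p. 183 (definition of M'ₘ)] -/
theorem phi_mPrime_of_buckets {N k4 k6 : ℕ} [NeZero N] {c : List ℤ} (hp : pairsB N c = true) {T4 T6 : KTree}
    (chunks4 : List (ℕ × ℕ)) (hcov4 : ∀ a, 1 ≤ a → a < N → ∃ p ∈ chunks4, p.1 ≤ a ∧ a < p.1 + p.2)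
    (h4 : ∀ p ∈ chunks4, checkFourChunk N k4 c T4 p.1 p.2 = true)
    (chunks6 : List (ℕ × ℕ)) (hcov6 : ∀ a, 1 ≤ a → a < N → ∃ p ∈ chunks6, p.1 ≤ a ∧ a < p.1 + p.2)
    (h6 : ∀ p ∈ chunks6, checkSixChunk N k6 c T6 p.1 p.2 = true) : ∀ ξ ∈ MPrime N, phi N c ξ = 0 := by
  intro ξ hξ
  induction hξ using AddSubmonoid.closure_induction with
  | mem g hg =>
    obtain ⟨hH, h2 | hq | ⟨-, t, u, ht3, hu3, hts, hus, rfl⟩⟩ := hg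
    · obtain ⟨a, ha, rfl⟩ := hH.eq_pair_of_card_eq_two h2
      exact phi_pair hp a ha
    · obtain ⟨a, b, c', d, rfl⟩ := Multiset.card_eq_four.mp hq
      have hd : d = -(a + b + c') := by
        have h0 := hH.1.2
        simp only [insert_eq_cons, sum_cons, sum_singleton] at h0
        linear_combination h0
      subst hd
      exact phi_four_of_checkFourChunk chunks4 hcov4 h4 a b c' hH
    · obtain ⟨a, b, x, rfl⟩ := Multiset.card_eq_three.mp ht3
      obtain ⟨c', d, y, rfl⟩ := Multiset.card_eq_three.mp hu3
      have hx : x = -(a + b) := by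
        simp only [insert_eq_cons, sum_cons, sum_singleton] at hts; linear_combination hts
      have hy : y = -(c' + d) := by
        simp only [insert_eq_cons, sum_cons, sum_singleton] at hus; linear_combination hus
      subst hx hy
      exact phi_semi_of_checkSixChunk chunks6 hcov6 h6 a b c' d hH
  | zero => exact phi_zero N c
  | add x y _ _ hx hy => rw [phi_add, hx, hy, add_zero]

/-- **Per class.** Under the same checks, a multiset `s` with `Φ_c(s) ≠ 0` (Hodge or not) is NOT stably in `M'_N`: there are no
`ξ₁, ξ₂ ∈ M'_N` with `s + ξ₂ = ξ₁` — the kernel form of the cell's verdict "no identity" for an individual `(Q)`-failing orbit.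
[cite: Shioda1979HodgeFermat, §4 condition (Qⁿₘ), pp. 183–184] -/
theorem not_stablyMem_of_buckets {N k4 k6 : ℕ} [NeZero N] {c : List ℤ} (hp : pairsB N c = true) {T4 T6 : KTree}
    (chunks4 : List (ℕ × ℕ)) (hcov4 : ∀ a, 1 ≤ a → a < N → ∃ p ∈ chunks4, p.1 ≤ a ∧ a < p.1 + p.2)
    (h4 : ∀ p ∈ chunks4, checkFourChunk N k4 c T4 p.1 p.2 = true)
    (chunks6 : List (ℕ × ℕ)) (hcov6 : ∀ a, 1 ≤ a → a < N → ∃ p ∈ chunks6, p.1 ≤ a ∧ a < p.1 + p.2)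
    (h6 : ∀ p ∈ chunks6, checkSixChunk N k6 c T6 p.1 p.2 = true)
    (s : Multiset (ZMod N)) (hphi : phi N c s ≠ 0) : ¬ ∃ ξ₁ ∈ MPrime N, ∃ ξ₂ ∈ MPrime N, s + ξ₂ = ξ₁ := by
  rintro ⟨ξ₁, h₁, ξ₂, h₂, heq⟩
  have e1 := phi_mPrime_of_buckets hp chunks4 hcov4 h4 chunks6 hcov6 h6 ξ₁ h₁
  have e2 := phi_mPrime_of_buckets hp chunks4 hcov4 h4 chunks6 hcov6 h6 ξ₂ h₂
  rw [← heq, phi_add, e2, add_zero] at e1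
  exact hphi e1

/-- **The obstruction, bucketed form.** If `Φ_c` is odd and the two `m²` checks pass against some trees, a Hodge sextuple `s` with
`Φ_c(s) ≠ 0` is not `ξ₁ − ξ₂` with `ξᵢ ∈ M'_N`: `(Q⁴_N)` fails. [cite: Shioda1979HodgeFermat, §4 condition (Qⁿₘ), pp. 183–184] -/
theorem not_conditionQ_four_of_buckets {N k4 k6 : ℕ} [NeZero N] {c : List ℤ} (hp : pairsB N c = true) {T4 T6 : KTree}
    (chunks4 : List (ℕ × ℕ)) (hcov4 : ∀ a, 1 ≤ a → a < N → ∃ p ∈ chunks4, p.1 ≤ a ∧ a < p.1 + p.2)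
    (h4 : ∀ p ∈ chunks4, checkFourChunk N k4 c T4 p.1 p.2 = true)
    (chunks6 : List (ℕ × ℕ)) (hcov6 : ∀ a, 1 ≤ a → a < N → ∃ p ∈ chunks6, p.1 ≤ a ∧ a < p.1 + p.2)
    (h6 : ∀ p ∈ chunks6, checkSixChunk N k6 c T6 p.1 p.2 = true)
    (s : Multiset (ZMod N)) (hs : IsHodgeMultiset s) (hcard : card s = 6) (hphi : phi N c s ≠ 0) : ¬ ConditionQ N 4 := by
  intro hQ
  obtain ⟨ξ₁, h₁, ξ₂, h₂, heq⟩ := hQ s hs (by omega) (by omega)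
  have e1 := phi_mPrime_of_buckets hp chunks4 hcov4 h4 chunks6 hcov6 h6 ξ₁ h₁
  have e2 := phi_mPrime_of_buckets hp chunks4 hcov4 h4 chunks6 hcov6 h6 ξ₂ h₂
  rw [← heq, phi_add, e2, add_zero] at e1
  exact hphi e1

end Summit.HodgeConjecture.FermatCycles.ConditionQObstruction
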